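import Summits.QuantumFields.GaugeBoot.DiagonalRPTorusSignExpansion
import Summits.QuantumFields.GaugeBoot.DiagonalRPTorusPlaquetteGraph
import Literature.MathematicalPhysics.QuantumFieldTheory.PolymerCombinatorics
import HarnessLib

/-!
# A polymer bound for the `ℤ₂` two-column sums on `(ℤ/L)³` (gauge-boot, task L3(ν), 2/4)

HONEST FRAMING (cell `pub-gaugeboot`, page 1 of every file): the venture produces certified bounds
on lattice expectations at stated coupling, gauge group, dimension and torus size; NOT a mass gap,
NOT a continuum limit, NOT a string tension; NOT Yang–Mills-summit-bearing (barriers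
`FixedCouplingUltralocality`, `PerturbativeInvisibility`). This module is bookkeeping for
structural NEGATIVE results about torus diagonal reflection positivity (the modules
`DiagonalRPTorusColumns` → `DiagonalRPTorusNegativeOdd` built on it); it discharges nothing by
itself.

## Content

`DiagonalRPTorusSignExpansion` reduces the RP form of a Polyakov-pair witness to the two-column
sums `K_t(A,B) = Σ_{S ⊆ plaquettes} t^{|S|} [∂S = column A + column B]` (`ksum`). For the `L = 3`
negative (`DiagonalRPTorusNegativeThree`) the crude estimate
`Σ_{|S| ≥ n} t^{|S|} ≤ (t/u)^n (1+u)^{#plaquettes}` sufficed; for general `L` it would force a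
coupling window shrinking like `2^{-3L²}`. Here the window is made UNIFORM in the torus size by the
standard polymer argument:

* `DiagRPThree.pow_mul_ksum_le` — **lower bound**: if some `S₀` has boundary `A + B`, then
  `t^{|S₀|} · 𝐙 ≤ K_t(A,B)` for `0 ≤ t ≤ 1`, where `𝐙 = K_t(C,C)` (any column `C`) is the
  closed-surface sum (inject closed `Z ↦ S₀ Δ Z`).
* `DiagRPThree.ksum_le_polymer` — **upper bound**: if every `S` with boundary `A + B` has at least
  `n` plaquettes, then `K_t(A,B) ≤ (44 t)^n · e^L · 𝐙` for `0 ≤ t ≤ 1/44`. Proof: split `S` into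
  the part `S₁` connected (through shared links) to the plaquettes touching the two columns and
  the remainder `S₂` — the tree's reindexing identity `Polymer.sum_powerset_eq_sum_seedConn`
  (`Literature/MathematicalPhysics/QuantumFieldTheory/PolymerCombinatorics`); `S₂` is closed and
  `S₁` still has boundary `A + B`, so `|S₁| ≥ n`; the entropy of the seed-connected `S₁` is
  controlled by the tree's Peierls–Kotecký–Preiss bounds `Polymer.sum_isConn_pow_card_le` /
  `Polymer.sum_isSeedConn_pow_card_le`, fed by the counts of `DiagonalRPTorusPlaquetteGraph`
  (plaquette adjacency has degree `≤ 16`; at most `8 L` plaquettes touch two columns; activity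
  `1/44 ≤ 1/(16e)`).

Sources: Osterwalder–Seiler, Ann. Phys. 110 (1978) 440, §3 (polymer expansion of lattice gauge
theory); Friedli–Velenik, *Statistical Mechanics of Lattice Systems* (2017), §5.2 and Lemma 3.38.
Elementary; the application to torus diagonal RP is, as far as the cell's searches go, not in
print.
-/

open MeasureTheory Complex Finset
open scoped ComplexOrder symmDiff

namespace Summit.QuantumFields.GaugeBoot

open Literature.MathematicalPhysics.QuantumFieldTheory

namespace DiagRPThree

/-! ## The closed-surface background factors out of lower bounds -/

section Lower

variable {L : ℕ} [NeZero L]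

/-- `J ∈ {0, 1}`. -/
theorem jind_eq_zero_or_one (S : Finset (Plaquette 3 L)) (A B : ZMod L × ZMod L) :
    jind S A B = 0 ∨ jind S A B = 1 := by
  unfold jind
  split_ifs
  · exact Or.inr rfl
  · exact Or.inl rfl

/-- `J_S(A,B) = 1` means `∂S = column A + column B`. -/
theorem even_of_jind_eq_one {S : Finset (Plaquette 3 L)} {A B : ZMod L × ZMod L}
    (h : jind S A B = 1) (e : Edge 3 L) : Even (degS S e + ccnt A e + ccnt B e) := by
  by_contra hne
  have h' : jind S A B = 0 := if_neg fun hall => hne (hall e)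
  rw [h'] at h
  exact zero_ne_one h

/-- The parity indicator only sees the boundary: `J_{S Δ Z}(A,B) = 1` when `J_S(A,B) = 1` and
`Z` is closed (`J_Z(C,C) = 1`). -/
theorem jind_symmDiff {S Z : Finset (Plaquette 3 L)} {A B C : ZMod L × ZMod L}
    (hS : jind S A B = 1) (hZ : jind Z C C = 1) : jind (S ∆ Z) A B = 1 := by
  refine if_pos fun e => ?_
  have h1 := even_of_jind_eq_one hS e
  have h2 : Even (degS Z e) := by
    have h := even_of_jind_eq_one hZ e
    rw [add_assoc, ← two_mul] at h
    exact (Nat.even_add.1 h).2 (even_two_mul _)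
  have h3 := degS_symmDiff_add S Z e
  have h4 : Even (degS (S ∆ Z) e + ccnt A e + ccnt B e + 2 * degS (S ∩ Z) e) := by
    rw [show degS (S ∆ Z) e + ccnt A e + ccnt B e + 2 * degS (S ∩ Z) e =
      (degS (S ∆ Z) e + 2 * degS (S ∩ Z) e) + ccnt A e + ccnt B e by ring, h3,
      show degS S e + degS Z e + ccnt A e + ccnt B e =
      (degS S e + ccnt A e + ccnt B e) + degS Z e by ring]
    exact h1.add h2
  exact (Nat.even_add.1 h4).2 (even_two_mul _)

/-- The closed-surface indicator `J_S(C,C) = [∂S = 0]` does not depend on the column `C`. -/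
theorem jind_self_eq (S : Finset (Plaquette 3 L)) (A C : ZMod L × ZMod L) :
    jind S A A = jind S C C := by
  unfold jind
  have h : ∀ D : ZMod L × ZMod L, (∀ e : Edge 3 L, Even (degS S e + ccnt D e + ccnt D e)) ↔
      ∀ e : Edge 3 L, Even (degS S e) := fun D => by
    refine forall_congr' fun e => ?_
    rw [add_assoc, ← two_mul]
    exact ⟨fun h => (Nat.even_add.1 h).2 (even_two_mul _), fun h => h.add (even_two_mul _)⟩
  simp only [h]

/-- `K_t(A,A) = K_t(C,C)`: the closed-surface sum `𝐙`. -/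
theorem ksum_self_eq (t : ℝ) (A C : ZMod L × ZMod L) : ksum t A A = ksum t C C := by
  unfold ksum
  simp only [jind_self_eq _ A C]

/-- **Lower bound with the background factored out.** If `S₀` has boundary `A + B`, then
`t^{|S₀|} · K_t(C,C) ≤ K_t(A,B)` for `0 ≤ t ≤ 1`: every closed `Z` contributes the surface
`S₀ Δ Z`, of boundary `A + B` and at most `|S₀| + |Z|` plaquettes. -/
theorem pow_mul_ksum_le {t : ℝ} (ht0 : 0 ≤ t) (ht1 : t ≤ 1) {A B : ZMod L × ZMod L}
    (C : ZMod L × ZMod L) {S₀ : Finset (Plaquette 3 L)}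
    (hS₀ : ∀ e : Edge 3 L, Even (degS S₀ e + ccnt A e + ccnt B e)) :
    t ^ S₀.card * ksum t C C ≤ ksum t A B := by
  have hJ : jind S₀ A B = 1 := if_pos hS₀
  have hre : ksum t A B = ∑ Z ∈ (univ : Finset (Plaquette 3 L)).powerset,
      t ^ (S₀ ∆ Z).card * jind (S₀ ∆ Z) A B := by
    unfold ksum
    symm
    exact sum_nbij' (fun Z => S₀ ∆ Z) (fun S => S₀ ∆ S)
      (fun Z _ => mem_powerset.2 (subset_univ _)) (fun S _ => mem_powerset.2 (subset_univ _))
      (fun Z _ => symmDiff_symmDiff_cancel_left _ _)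
      (fun S _ => symmDiff_symmDiff_cancel_left _ _) (fun Z _ => rfl)
  rw [hre, ksum, mul_sum]
  refine sum_le_sum fun Z _ => ?_
  rcases jind_eq_zero_or_one Z C C with hZ | hZ
  · rw [hZ, mul_zero, mul_zero]
    exact mul_nonneg (pow_nonneg ht0 _) (jind_nonneg _ _ _)
  · rw [hZ, mul_one, jind_symmDiff hJ hZ, mul_one, ← pow_add]
    refine pow_le_pow_of_le_one ht0 ht1 ?_
    calc (S₀ ∆ Z).card ≤ (S₀ ∪ Z).card := card_le_card symmDiff_subset_union
      _ ≤ S₀.card + Z.card := card_union_le _ _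

end Lower

/-! ## The split `S = S₁ ⊔ S₂` and the upper bound -/

section Upper

variable {L : ℕ} [NeZero L]

/-- **The remainder is closed and the seeded part keeps the boundary.** If `S₂` avoids the seeded
neighbourhood of `S₁` (no plaquette of `S₂` touches the columns or shares a link with `S₁`), then
`J_{S₁ ∪ S₂}(A,B) ≤ J_{S₁}(A,B) · J_{S₂}(A,A)`: a boundary `A + B` for the union forces the
boundary `A + B` on `S₁` and closedness of `S₂`. -/
theorem jind_union_le [DecidableRel (padj (L := L))] {A B : ZMod L × ZMod L}
    [DecidablePred (touches A B)] {S₁ S₂ : Finset (Plaquette 3 L)}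
    (h₂ : S₂ ⊆ univ \ Polymer.snbhd padj (touches A B) univ S₁) :
    jind (S₁ ∪ S₂) A B ≤ jind S₁ A B * jind S₂ A A := by
  rcases jind_eq_zero_or_one (S₁ ∪ S₂) A B with h | h
  · rw [h]
    exact mul_nonneg (jind_nonneg _ _ _) (jind_nonneg _ _ _)
  rw [h]
  have hdisj : Disjoint S₁ S₂ := by
    haveI : Std.Refl (padj (L := L)) := ⟨padj_refl⟩
    exact Polymer.disjoint_of_subset_sdiff_snbhd (subset_univ S₁) h₂
  have hout : ∀ q ∈ S₂, ¬ touches A B q ∧ ∀ p ∈ S₁, ¬ padj p q := by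
    intro q hq
    have hq' := (mem_sdiff.1 (h₂ hq)).2
    rw [Polymer.mem_snbhd, not_and_or] at hq'
    rcases hq' with hq' | hq'
    · exact absurd (mem_univ q) hq'
    · rw [not_or, not_exists] at hq'
      exact ⟨hq'.1, fun p hp hpq => hq'.2 p ⟨hp, hpq⟩⟩
  have key : ∀ e : Edge 3 L, Even (degS S₁ e + ccnt A e + ccnt B e) ∧ Even (degS S₂ e) := by
    intro e
    have hsum : degS (S₁ ∪ S₂) e = degS S₁ e + degS S₂ e := sum_union hdisj
    have he := even_of_jind_eq_one h e
    rw [hsum] at he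
    by_cases h0 : degS S₂ e = 0
    · rw [h0, add_zero] at he
      rw [h0]
      exact ⟨he, Even.zero⟩
    · obtain ⟨q, hq, hqe⟩ := exists_ne_zero_of_sum_ne_zero h0
      obtain ⟨hqt, hqa⟩ := hout q hq
      have hA : ccnt A e = 0 := by
        by_contra hA
        exact hqt ⟨e, hqe, Or.inl hA⟩
      have hB : ccnt B e = 0 := by
        by_contra hB
        exact hqt ⟨e, hqe, Or.inr hB⟩
      have h1 : degS S₁ e = 0 := by
        refine sum_eq_zero fun p hp => ?_
        by_contra hpe
        exact hqa p hp ⟨e, hpe, hqe⟩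
      rw [h1, hA, hB, zero_add, add_zero, add_zero] at he
      rw [h1, hA, hB]
      exact ⟨Even.zero, he⟩
  have hJ1 : jind S₁ A B = 1 := if_pos fun e => (key e).1
  have hJ2 : jind S₂ A A = 1 := by
    refine if_pos fun e => ?_
    rw [add_assoc, ← two_mul]
    exact (key e).2.add (even_two_mul _)
  rw [hJ1, hJ2, mul_one]

open Classical in
/-- **The split.** `K_t(A,B) ≤ Φ_t(A,B) · K_t(A,A)` for `t ≥ 0`, where
`Φ_t(A,B) = Σ_{S₁ seed-connected} t^{|S₁|} J_{S₁}(A,B)` runs over the plaquette sets every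
component of which touches one of the two columns. -/
theorem ksum_le_seedConn_mul {t : ℝ} (ht : 0 ≤ t) (A B : ZMod L × ZMod L) :
    ksum t A B ≤ (∑ S₁ ∈ (univ : Finset (Plaquette 3 L)).powerset.filter
      (Polymer.IsSeedConn padj (touches A B)), t ^ S₁.card * jind S₁ A B) * ksum t A A := by
  haveI : Std.Refl (padj (L := L)) := ⟨padj_refl⟩
  unfold ksum
  rw [Polymer.sum_powerset_eq_sum_seedConn (adj := padj) (s := touches A B) univ
    (fun S => t ^ S.card * jind S A B), sum_mul]
  refine sum_le_sum fun S₁ _ => ?_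
  rw [mul_assoc]
  calc ∑ S₂ ∈ (univ \ Polymer.snbhd padj (touches A B) univ S₁).powerset,
        t ^ (S₁ ∪ S₂).card * jind (S₁ ∪ S₂) A B
      ≤ ∑ S₂ ∈ (univ \ Polymer.snbhd padj (touches A B) univ S₁).powerset,
          jind S₁ A B * (t ^ S₂.card * jind S₂ A A) * t ^ S₁.card := by
        refine sum_le_sum fun S₂ hS₂ => ?_
        rw [mem_powerset] at hS₂
        have hdisj : Disjoint S₁ S₂ :=
          Polymer.disjoint_of_subset_sdiff_snbhd (subset_univ S₁) hS₂
        rw [card_union_of_disjoint hdisj, pow_add]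
        calc t ^ S₁.card * t ^ S₂.card * jind (S₁ ∪ S₂) A B
            ≤ t ^ S₁.card * t ^ S₂.card * (jind S₁ A B * jind S₂ A A) :=
              mul_le_mul_of_nonneg_left (jind_union_le hS₂)
                (mul_nonneg (pow_nonneg ht _) (pow_nonneg ht _))
          _ = jind S₁ A B * (t ^ S₂.card * jind S₂ A A) * t ^ S₁.card := by ring
    _ = t ^ S₁.card * (jind S₁ A B * ∑ S₂ ∈ (univ \
          Polymer.snbhd padj (touches A B) univ S₁).powerset, t ^ S₂.card * jind S₂ A A) := by
        rw [← sum_mul, ← mul_sum]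
        ring
    _ ≤ t ^ S₁.card * (jind S₁ A B *
          ∑ S₂ ∈ (univ : Finset (Plaquette 3 L)).powerset, t ^ S₂.card * jind S₂ A A) := by
        refine mul_le_mul_of_nonneg_left (mul_le_mul_of_nonneg_left ?_ (jind_nonneg _ _ _))
          (pow_nonneg ht _)
        exact sum_le_sum_of_subset_of_nonneg (powerset_mono.2 (subset_univ _))
          fun S₂ _ _ => mul_nonneg (pow_nonneg ht _) (jind_nonneg _ _ _)

open Classical in
/-- **Entropy of the seed-connected part.** If every surface with boundary `A + B` has at least
`n` plaquettes, then `Φ_t(A,B) ≤ (44 t)^n · e^L` for `0 ≤ t ≤ 1/44` (Peierls–Kotecký–Preiss with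
degree `16`, `θ = 1/16`, activity `1/44 ≤ 1/(16 e)`, at most `8 L` seeds). -/
theorem seedConn_sum_le {A B : ZMod L × ZMod L} {n : ℕ}
    (hn : ∀ S : Finset (Plaquette 3 L), (∀ e, Even (degS S e + ccnt A e + ccnt B e)) →
      n ≤ S.card)
    {t : ℝ} (ht0 : 0 ≤ t) (ht1 : t ≤ 1 / 44) :
    ∑ S₁ ∈ (univ : Finset (Plaquette 3 L)).powerset.filter
        (Polymer.IsSeedConn padj (touches A B)), t ^ S₁.card * jind S₁ A B ≤
      (44 * t) ^ n * Real.exp L := by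
  haveI : Std.Symm (padj (L := L)) := ⟨fun _ _ => padj_symm⟩
  set F := (univ : Finset (Plaquette 3 L)).powerset.filter
    (Polymer.IsSeedConn padj (touches A B)) with hF
  -- termwise: `t^{|S₁|} J ≤ (44 t)^n (1/44)^{|S₁|}`
  have hterm : ∀ S₁ ∈ F, t ^ S₁.card * jind S₁ A B ≤
      (44 * t) ^ n * (1 / 44 : ℝ) ^ S₁.card := by
    intro S₁ _
    rcases jind_eq_zero_or_one S₁ A B with h | h
    · rw [h, mul_zero]
      positivity
    · rw [h, mul_one]
      have hS : n ≤ S₁.card := hn S₁ (even_of_jind_eq_one h)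
      calc t ^ S₁.card = (44 * t) ^ S₁.card * (1 / 44 : ℝ) ^ S₁.card := by
            rw [← mul_pow]; ring
        _ ≤ (44 * t) ^ n * (1 / 44 : ℝ) ^ S₁.card :=
            mul_le_mul_of_nonneg_right (pow_le_pow_of_le_one (by positivity) (by linarith) hS)
              (by positivity)
  -- the Peierls–Kotecký–Preiss bound for rooted connected sets, then the gas of components
  have hconn : ∀ a ∈ (univ : Finset (Plaquette 3 L)).filter (touches A B),
      ∑ C ∈ (univ : Finset (Plaquette 3 L)).powerset.filter (fun C => Polymer.IsConn padj C a),
        (1 / 44 : ℝ) ^ C.card ≤ 1 / 16 := by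
    intro a _
    refine Polymer.sum_isConn_pow_card_le (adj := padj) 16 (fun a P => card_filter_padj_le a P)
      (by norm_num) ?_ univ a
    have he := Real.exp_one_lt_d9
    norm_num at he ⊢
    nlinarith
  have hgas := Polymer.sum_isSeedConn_pow_card_le (adj := padj) (s := touches A B)
    (y := (1 / 44 : ℝ)) (θ := 1 / 16) (by norm_num) univ hconn
  have hseeds : (((univ : Finset (Plaquette 3 L)).filter (touches A B)).card : ℝ) * (1 / 16) ≤
      L := by
    have h' : (((univ : Finset (Plaquette 3 L)).filter (touches A B)).card : ℝ) ≤ 8 * L := by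
      exact_mod_cast card_filter_touches_le (L := L) A B
    nlinarith
  calc ∑ S₁ ∈ F, t ^ S₁.card * jind S₁ A B
      ≤ ∑ S₁ ∈ F, (44 * t) ^ n * (1 / 44 : ℝ) ^ S₁.card := sum_le_sum hterm
    _ = (44 * t) ^ n * ∑ S₁ ∈ F, (1 / 44 : ℝ) ^ S₁.card := by rw [mul_sum]
    _ ≤ (44 * t) ^ n * Real.exp
          ((((univ : Finset (Plaquette 3 L)).filter (touches A B)).card : ℝ) * (1 / 16)) :=
        mul_le_mul_of_nonneg_left hgas (by positivity)
    _ ≤ (44 * t) ^ n * Real.exp L :=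
        mul_le_mul_of_nonneg_left (Real.exp_le_exp.2 hseeds) (by positivity)

/-- **The polymer bound.** If every surface with boundary `column A + column B` has at least `n`
plaquettes, then `K_t(A,B) ≤ (44 t)^n · e^L · K_t(C,C)` for `0 ≤ t ≤ 1/44` and any column `C`
(`K_t(C,C)` is the closed-surface sum). -/
theorem ksum_le_polymer {A B : ZMod L × ZMod L} {n : ℕ}
    (hn : ∀ S : Finset (Plaquette 3 L), (∀ e, Even (degS S e + ccnt A e + ccnt B e)) →
      n ≤ S.card)
    {t : ℝ} (ht0 : 0 ≤ t) (ht1 : t ≤ 1 / 44) (C : ZMod L × ZMod L) :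
    ksum t A B ≤ (44 * t) ^ n * Real.exp L * ksum t C C := by
  rw [← ksum_self_eq t A C]
  exact (ksum_le_seedConn_mul ht0 A B).trans
    (mul_le_mul_of_nonneg_right (seedConn_sum_le hn ht0 ht1) (ksum_nonneg ht0 _ _))

end Upper

end DiagRPThree

end Summit.QuantumFields.GaugeBoot
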